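import Summits.QuantumFields.YangMills.Theorems.VirialFluxGapCommutatorFirstVariation
import HarnessLib

/-!
# Route `VirialFluxGap` (YangMills): quaternion calculus along one-variable frame curves — `d/ds q(u·e^{sY}) = q·p`, and the derivative of a
# commutator norm under radial tangents

Brick (C1-ii) of the central charts for ⟨stmt-QuantumFields-24141⟩ (LEAD design notes №2∕№4).  On constant ring histories the zero-flux deficit is a
sum of commutator norms `‖A B − B A‖²` of the variables' unit quaternions (✓`ConstantHistory.ringDeficit_const_eq_commutator_quartic`); the
zero-mode block field (✓`CentralZeroModeField`) turns each variable `u` along `s ↦ u·e^{sY}` with `Y = quatMatrix p`, `p = ½σ·Im q(u)`.  Here: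

* §1 ★ `hasDerivAt_su2Quat_mul_expSU` — the unit quaternion of the moving variable is differentiable with derivative `q(u·e^{sY})·p`
  (`su2Quat` reads the first row, a real-linear map of the matrix; ✓`coe_mul_quatMatrix`);
* §2 ★ `hasDerivAt_normSq_comm` — for differentiable quaternion curves `A, B`: `d/ds ‖A B − B A‖² = 2⟨[A,B], [A′,B] + [A,B′]⟩`
  (componentwise inner product, `‖·‖² = normSq`);
* §3 ★★ `hasDerivAt_normSq_comm_radial` — with RADIAL tangents `A′ = c_a·A·Im A`, `B′ = c_b·B·Im B` the derivative is
  `2(c_a·Re A + c_b·Re B)·‖[A,B]‖²` (✓`comm_first_variation`): each commutator quartic term is reproduced with the factor `c_a Re A + c_b Re B`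
  (`= 1` for `c = ½σ` at the central toron).

HONEST FRAMING: one-variable calculus; no chart inequality is proved; ⟨24141⟩ stays OPEN; the Yang–Mills mass gap is NOT proved; no summit is
proved by a line.  THEOREMS ONLY (0 `def`, 0 `sorry`), standard axioms.  Width seat `ym-line-sfw-p2-w3` g58 (cell ym-idea-1, free hands),
`--supports stmt-QuantumFields-24141`.  References: [cite: arXiv220412737, §2 (2.4) (p. 10)]; [cite: CosteEtAl1985].
-/

set_option autoImplicit false

noncomputable section

open scoped Matrix ContDiff Topology Quaternion
open Literature.MathematicalPhysics.QuantumFieldTheory hiding SU2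
open Literature.MathematicalPhysics.QuantumLattice
open Literature.MathematicalPhysics.QuantumFieldTheory.SUNBakryEmery (expSU coe_expSU matTop exp_smul_mul_self)

namespace Summit.QuantumFields.YangMills.Theorems.VirialFluxGap.FrameDerivative

open Summit.QuantumFields.YangMills.Theorems.FemtoTransferGap

open scoped Matrix.Norms.Frobenius

attribute [local instance 2000] Literature.MathematicalPhysics.QuantumFieldTheory.SUNBakryEmery.matTop

/-! ## §1 The quaternion of a variable moving along a frame curve -/

/-- The first row of a `2×2` complex matrix as a quaternion: a continuous real-linear map extending `su2Quat`. [folklore] -/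
theorem exists_firstRow_clm :
    ∃ ρ : Matrix (Fin 2) (Fin 2) ℂ →L[ℝ] ℍ, (∀ X, ρ X = ⟨(X 0 0).re, (X 0 0).im, (X 0 1).re, (X 0 1).im⟩) ∧ ∀ U : SU2, ρ (U : Matrix (Fin 2) (Fin 2) ℂ) = su2Quat U := by
  refine ⟨LinearMap.toContinuousLinearMap
      { toFun := fun X => ⟨(X 0 0).re, (X 0 0).im, (X 0 1).re, (X 0 1).im⟩
        map_add' := fun X Y => by ext <;> simp
        map_smul' := fun c X => by ext <;> simp }, fun X => rfl, fun U => rfl⟩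

/-- The first row of `quatMatrix r` is `r`. [folklore] -/
theorem firstRow_quatMatrix (ρ : Matrix (Fin 2) (Fin 2) ℂ →L[ℝ] ℍ) (hρ : ∀ X, ρ X = ⟨(X 0 0).re, (X 0 0).im, (X 0 1).re, (X 0 1).im⟩) (r : ℍ) :
    ρ (quatMatrix r) = r := by
  rw [hρ]; ext <;> simp

/-- ★ **The quaternion of the moving variable is differentiable**: for `Y = quatMatrix p` skew-Hermitian traceless,
`d/ds su2Quat(u·e^{sY}) = su2Quat(u·e^{sY})·p` at every `s`. [cite: arXiv220412737, §2 (2.4) (p. 10)] -/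
theorem hasDerivAt_su2Quat_mul_expSU (u : SU2) (p : ℍ) (hY : (quatMatrix p)ᴴ = -quatMatrix p) (hY0 : (quatMatrix p).trace = 0) (s : ℝ) :
    HasDerivAt (fun s : ℝ => su2Quat (u * expSU (N := 2) hY hY0 s)) (su2Quat (u * expSU (N := 2) hY hY0 s) * p) s := by
  obtain ⟨ρ, hρ, hρU⟩ := exists_firstRow_clm
  have heq : (fun s : ℝ => su2Quat (u * expSU (N := 2) hY hY0 s)) =
      fun s => ρ ((u : Matrix (Fin 2) (Fin 2) ℂ) * NormedSpace.exp (s • quatMatrix p)) := by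
    funext s
    rw [← hρU, Submonoid.coe_mul, coe_expSU]; rfl
  rw [heq]
  have hmat : HasDerivAt (fun s : ℝ => (u : Matrix (Fin 2) (Fin 2) ℂ) * NormedSpace.exp (s • quatMatrix p))
      ((u : Matrix (Fin 2) (Fin 2) ℂ) * (quatMatrix p * NormedSpace.exp (s • quatMatrix p))) s :=
    (hasDerivAt_exp_smul_const' (𝕂 := ℝ) (quatMatrix p) s).const_mul _
  have h := ρ.hasFDerivAt.comp_hasDerivAt s hmat
  refine h.congr_deriv ?_
  -- `ρ (u · (Y · e^{sY})) = ρ ((u e^{sY}) · Y) = su2Quat(u e^{sY}) · p`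
  have hcomm : (u : Matrix (Fin 2) (Fin 2) ℂ) * (quatMatrix p * NormedSpace.exp (s • quatMatrix p)) =
      ((u * expSU (N := 2) hY hY0 s : SU2) : Matrix (Fin 2) (Fin 2) ℂ) * quatMatrix p := by
    rw [Submonoid.coe_mul, coe_expSU, Matrix.mul_assoc, exp_smul_mul_self]; rfl
  show ρ ((u : Matrix (Fin 2) (Fin 2) ℂ) * (quatMatrix p * NormedSpace.exp (s • quatMatrix p))) = su2Quat (u * expSU (N := 2) hY hY0 s) * p
  rw [hcomm, coe_mul_quatMatrix, firstRow_quatMatrix ρ hρ]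

/-! ## §2 The derivative of a commutator norm along quaternion curves -/

/-- The componentwise inner product of quaternions is the real inner product. [folklore] -/
theorem inner_eq_components (x y : ℍ) : inner ℝ x y = x.re * y.re + x.imI * y.imI + x.imJ * y.imJ + x.imK * y.imK := by
  rw [Quaternion.inner_def]
  simp only [Quaternion.re_mul, Quaternion.re_star, Quaternion.imI_star, Quaternion.imJ_star, Quaternion.imK_star]
  ring

/-- ★ **Derivative of a commutator norm**: `d/ds ‖A B − B A‖² = 2⟨[A,B], [A′,B] + [A,B′]⟩` (componentwise). [folklore] -/
theorem hasDerivAt_normSq_comm {A B : ℝ → ℍ} {A' B' : ℍ} {s : ℝ} (hA : HasDerivAt A A' s) (hB : HasDerivAt B B' s) :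
    HasDerivAt (fun s => Quaternion.normSq (A s * B s - B s * A s))
      (2 * ((A s * B s - B s * A s).re * (A' * B s - B s * A' + (A s * B' - B' * A s)).re +
        (A s * B s - B s * A s).imI * (A' * B s - B s * A' + (A s * B' - B' * A s)).imI +
        (A s * B s - B s * A s).imJ * (A' * B s - B s * A' + (A s * B' - B' * A s)).imJ +
        (A s * B s - B s * A s).imK * (A' * B s - B s * A' + (A s * B' - B' * A s)).imK)) s := by
  have hC : HasDerivAt (fun s => A s * B s - B s * A s) (A' * B s + A s * B' - (B' * A s + B s * A')) s :=
    (hA.fun_mul hB).sub (hB.fun_mul hA)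
  have hN := hC.norm_sq
  have heq : (fun s => Quaternion.normSq (A s * B s - B s * A s)) = fun s => ‖A s * B s - B s * A s‖ ^ 2 := by
    funext s; rw [Quaternion.normSq_eq_norm_mul_self, sq]
  rw [heq]
  refine hN.congr_deriv ?_
  rw [inner_eq_components]
  have e : A' * B s + A s * B' - (B' * A s + B s * A') = A' * B s - B s * A' + (A s * B' - B' * A s) := by abel
  rw [e]

/-! ## §3 Radial tangents reproduce the commutator norm -/

/-- ★★ **Radial tangents reproduce the commutator norm**: if `A′ = c_a·A·Im A` and `B′ = c_b·B·Im B` then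
`d/ds ‖A B − B A‖² = 2(c_a·Re A + c_b·Re B)·‖A B − B A‖²`. [cite: CosteEtAl1985] -/
theorem hasDerivAt_normSq_comm_radial {A B : ℝ → ℍ} {ca cb : ℝ} {s : ℝ}
    (hA : HasDerivAt A (ca • (A s * (A s).im)) s) (hB : HasDerivAt B (cb • (B s * (B s).im)) s) :
    HasDerivAt (fun s => Quaternion.normSq (A s * B s - B s * A s))
      (2 * (ca * (A s).re + cb * (B s).re) * Quaternion.normSq (A s * B s - B s * A s)) s := by
  have h := hasDerivAt_normSq_comm hA hB
  refine h.congr_deriv ?_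
  have e1 : ca • (A s * (A s).im) * B s - B s * (ca • (A s * (A s).im)) = ca • (A s * (A s).im * B s - B s * (A s * (A s).im)) := by
    rw [smul_mul_assoc, mul_smul_comm, smul_sub]
  have e2 : A s * (cb • (B s * (B s).im)) - cb • (B s * (B s).im) * A s = cb • (A s * (B s * (B s).im) - B s * (B s).im * A s) := by
    rw [mul_smul_comm, smul_mul_assoc, smul_sub]
  rw [e1, e2]
  exact comm_first_variation (A s) (B s) ca cb

end Summit.QuantumFields.YangMills.Theorems.VirialFluxGap.FrameDerivative

end
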